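import Literature.MathematicalPhysics.QuantumLattice.SchwingerOSPositivity
import HarnessLib

/-!
# Time–space tensor test functions `T(x⁰) S(x⃗)` on configuration space

Osterwalder–Schrader II (Comm. Math. Phys. 42 (1975)), Ch. V–VI: the test functions of the
continuation argument are products of functions of the times with functions of the spatial
variables ("`S_k(x⁰ | h) = ∫ S_k(x) h(x⃗) dx⃗`", (5.3); the time averages of Ch. VI.1 act on the time
factor only). This file builds, for `m` points in `ℝ^{d'+1} = ℝ × ℝ^{d'}`:

* `timeProj`, `spaceProj` — the continuous linear projections of a configuration
  `x ∈ (ℝ^{d'+1})ᵐ` onto its times `(xⱼ⁰)ⱼ ∈ ℝᵐ` and its spatial parts `(x⃗ⱼ)ⱼ ∈ (ℝ^{d'})ᵐ`, with the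
  norm control `‖x‖ ≤ 2 max(‖times‖, ‖spatial parts‖)` (`norm_le_two_mul_max_proj`);
* `timeSpaceTensor T S` — the Schwartz function `x ↦ T((xⱼ⁰)ⱼ) S((x⃗ⱼ)ⱼ)` for
  `T ∈ 𝓢(ℝᵐ)`, `S ∈ 𝓢((ℝ^{d'})ᵐ)` (the tree's `SchwartzMap.mulComp`), its values and the
  **seminorm bound** `p_{k,l}(T ⊗ S) ≤ mulCompBound … 2 k l T S` — a finite combination of
  products of seminorms of `T` and of `S` (`seminorm_timeSpaceTensor_le`), so that bounds on the
  time factor that are uniform in a regularisation pass to the full test function.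

## References

* K. Osterwalder, R. Schrader, *Axioms for Euclidean Green's functions II*, Comm. Math. Phys.
  42 (1975) 281–305, Ch. V (5.3), Ch. VI.1. [OsterwalderSchraderCMP1975]
-/

noncomputable section

open scoped SchwartzMap

namespace Literature.MathematicalPhysics.QuantumFieldTheory

variable {d' m : ℕ}

/-! ### The projections -/

/-- The time coordinate of a point of `ℝ^{d'+1}` as a continuous linear map. [folklore] -/
def timeCoord : EuclideanSpace ℝ (Fin (d' + 1)) →L[ℝ] ℝ := EuclideanSpace.proj 0

/-- The spatial part of a point of `ℝ^{d'+1}` as a continuous linear map to `ℝ^{d'}`. [folklore] -/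
def spacePart : EuclideanSpace ℝ (Fin (d' + 1)) →L[ℝ] EuclideanSpace ℝ (Fin d') :=
  LinearMap.toContinuousLinearMap
    { toFun := fun y => WithLp.toLp 2 fun i => y (Fin.succ i)
      map_add' := fun y y' => by ext i; simp
      map_smul' := fun c y => by ext i; simp }

/-- Values of `timeCoord`. [folklore] -/
@[simp] theorem timeCoord_apply (y : EuclideanSpace ℝ (Fin (d' + 1))) : timeCoord y = y 0 := rfl

/-- Values of `spacePart`. [folklore] -/
@[simp] theorem spacePart_apply (y : EuclideanSpace ℝ (Fin (d' + 1))) (i : Fin d') :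
    spacePart y i = y (Fin.succ i) := rfl

/-- `‖y‖² = |y⁰|² + ‖y⃗‖²`. [folklore] -/
theorem norm_sq_eq_time_add_space (y : EuclideanSpace ℝ (Fin (d' + 1))) :
    ‖y‖ ^ 2 = (y 0) ^ 2 + ‖spacePart y‖ ^ 2 := by
  rw [EuclideanSpace.norm_sq_eq, EuclideanSpace.norm_sq_eq, Fin.sum_univ_succ]
  simp [spacePart_apply, Real.norm_eq_abs, sq_abs]

/-- `‖y‖ ≤ 2 max(|y⁰|, ‖y⃗‖)`. [folklore] -/
theorem norm_le_two_mul_max (y : EuclideanSpace ℝ (Fin (d' + 1))) :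
    ‖y‖ ≤ 2 * max |y 0| ‖spacePart y‖ := by
  have h := norm_sq_eq_time_add_space y
  have h1 : |y 0| ≤ max |y 0| ‖spacePart y‖ := le_max_left _ _
  have h2 : ‖spacePart y‖ ≤ max |y 0| ‖spacePart y‖ := le_max_right _ _
  have hM : 0 ≤ max |y 0| ‖spacePart y‖ := le_trans (abs_nonneg _) h1
  have hsq : ‖y‖ ^ 2 ≤ (2 * max |y 0| ‖spacePart y‖) ^ 2 := by
    rw [h]
    nlinarith [sq_abs (y 0), sq_nonneg (|y 0|), sq_nonneg ‖spacePart y‖,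
      mul_le_mul h1 h1 (abs_nonneg _) hM, mul_le_mul h2 h2 (norm_nonneg _) hM]
  exact le_of_pow_le_pow_left₀ two_ne_zero (by positivity) hsq

variable (d' m) in
/-- The **time projection** of a configuration: `x ↦ (xⱼ⁰)ⱼ`. [folklore] -/
def timeProj : (Fin m → EuclideanSpace ℝ (Fin (d' + 1))) →L[ℝ] (Fin m → ℝ) :=
  ContinuousLinearMap.pi fun j => timeCoord.comp (ContinuousLinearMap.proj j)

variable (d' m) in
/-- The **space projection** of a configuration: `x ↦ (x⃗ⱼ)ⱼ`. [folklore] -/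
def spaceProj : (Fin m → EuclideanSpace ℝ (Fin (d' + 1))) →L[ℝ] (Fin m → EuclideanSpace ℝ (Fin d')) :=
  ContinuousLinearMap.pi fun j => spacePart.comp (ContinuousLinearMap.proj j)

/-- Values of the time projection. [folklore] -/
@[simp] theorem timeProj_apply (x : Fin m → EuclideanSpace ℝ (Fin (d' + 1))) (j : Fin m) :
    timeProj d' m x j = x j 0 := rfl

/-- Values of the space projection. [folklore] -/
@[simp] theorem spaceProj_apply (x : Fin m → EuclideanSpace ℝ (Fin (d' + 1))) (j : Fin m) :
    spaceProj d' m x j = spacePart (x j) := rfl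

/-- **Norm control by the projections**: `‖x‖ ≤ 2 max(‖times‖, ‖spatial parts‖)`. [folklore] -/
theorem norm_le_two_mul_max_proj (x : Fin m → EuclideanSpace ℝ (Fin (d' + 1))) :
    ‖x‖ ≤ 2 * max ‖timeProj d' m x‖ ‖spaceProj d' m x‖ := by
  refine (pi_norm_le_iff_of_nonneg (by positivity)).2 fun j => ?_
  refine (norm_le_two_mul_max (x j)).trans ?_
  gcongr
  · rw [← Real.norm_eq_abs]; exact norm_le_pi_norm (timeProj d' m x) j
  · exact norm_le_pi_norm (spaceProj d' m x) j

/-! ### The tensor -/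

variable (d' m) in
/-- The **time–space tensor** `x ↦ T((xⱼ⁰)ⱼ) S((x⃗ⱼ)ⱼ)` of a time test function and a space test
function. [cite: OsterwalderSchraderCMP1975, Ch. V (5.3)] -/
def timeSpaceTensor (T : 𝓢((Fin m → ℝ), ℂ)) (S : 𝓢((Fin m → EuclideanSpace ℝ (Fin d')), ℂ)) :
    𝓢((Fin m → EuclideanSpace ℝ (Fin (d' + 1))), ℂ) :=
  SchwartzMap.mulComp T S (timeProj d' m) (spaceProj d' m) ⟨2, norm_le_two_mul_max_proj⟩

/-- Values of the time–space tensor. [folklore] -/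
@[simp] theorem timeSpaceTensor_apply (T : 𝓢((Fin m → ℝ), ℂ)) (S : 𝓢((Fin m → EuclideanSpace ℝ (Fin d')), ℂ))
    (x : Fin m → EuclideanSpace ℝ (Fin (d' + 1))) :
    timeSpaceTensor d' m T S x = T (fun j => x j 0) * S (fun j => spacePart (x j)) := rfl

/-- **Seminorm bound for the time–space tensor**: a finite combination of products of seminorms of
the two factors (`SchwartzMap.seminorm_mulComp_le`). [folklore] -/
theorem seminorm_timeSpaceTensor_le (T : 𝓢((Fin m → ℝ), ℂ)) (S : 𝓢((Fin m → EuclideanSpace ℝ (Fin d')), ℂ))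
    (k l : ℕ) :
    SchwartzMap.seminorm ℂ k l (timeSpaceTensor d' m T S) ≤
      SchwartzMap.mulCompBound (timeProj d' m) (spaceProj d' m) 2 k l T S :=
  SchwartzMap.seminorm_mulComp_le T S _ _ _ norm_le_two_mul_max_proj k l

/-- The time–space tensor is bilinear: additive in the time factor. [folklore] -/
theorem timeSpaceTensor_add_left (T T' : 𝓢((Fin m → ℝ), ℂ)) (S : 𝓢((Fin m → EuclideanSpace ℝ (Fin d')), ℂ)) :
    timeSpaceTensor d' m (T + T') S = timeSpaceTensor d' m T S + timeSpaceTensor d' m T' S := by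
  ext x; simp [add_mul]

/-- The time–space tensor is homogeneous in the time factor. [folklore] -/
theorem timeSpaceTensor_smul_left (c : ℂ) (T : 𝓢((Fin m → ℝ), ℂ)) (S : 𝓢((Fin m → EuclideanSpace ℝ (Fin d')), ℂ)) :
    timeSpaceTensor d' m (c • T) S = c • timeSpaceTensor d' m T S := by
  ext x; simp [mul_assoc]

end Literature.MathematicalPhysics.QuantumFieldTheory
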